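import Summits.AtomisticToContinuum.Crystallization.Theorems.ChartedZeroExcessLayeredLatticeLiouvilleZZZYRCHA

/-!
# Charted zero-excess layered-lattice Liouville — ZZZYRCH: THE GENERIC TAIL THEOREM of line (D) (FUB + TL-2, PROVED; part b)

Cell `decomp-a2c`, lens 2, generation 99.  Critic r1805 (A2): «BoxTailDebitP from ONE generic tail theorem (TL-1/TL-IS tree-bound + FUB + TL-2
still open, lens-2 owes)».  This file (with its part a, ZZZYRCHA: path data `IsPathSystem`, scheme coefficients, `SchemeDominatedP`,
`far_pair_lower`) discharges it.  Over an ARBITRARY `c`-co-Lipschitz layered word `(a, b, w)` (`IsLayeredCrystal c a b w`, `0 < c`), given path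
data `np, z` with `IsPathSystem ϱ a b w np z` and tables with `SchemeDominatedP ϱ α a b w np z ΘR ΘN` (partial-sum form: for every finite set
`X` of far pairs and every pair `y`, the scheme increments routed through `y` sum to at most `ΘR y`, `ΘN y`), the tail inequality of (TL♯-D)
holds with `γT = 0`: `rangeHessSum ϱ a b w φ − debitForm ϱ ΘR ΘN a b w φ ≤ E` for every finitely supported `φ` and every value `E` of the
ordered-pair harmonic form (`rangeHessSum_sub_debitForm_le`).  PROOF: (FUB) finite regrouping `regroup_le` + domination bound every finite
partial sum of the majorants by `Σ_{pieces} pairDebit ≤ debitForm` (`sum_pairDebit_le_debitForm`, `sum_schemeMajorant_le_debitForm`); hence the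
majorant family is summable with `tsum ≤ debitForm` (`summable_of_sum_le`); (TL-2) the harmonic form splits as the FINITE near part
`= rangeHessSum ϱ` (pairs of length `0` are diagonal by `injective_lsite_of_isLayeredCrystal`) plus the far `HasSum`, bounded below by `−tsum`
through `far_pair_lower` and `hasSum_le`.  COROLLARY `boxTailDebitP_of_scheme`: `BoxSchemeP ⇒ BoxTailDebitP … 0` — the (∀ i, BoxTail)
hypothesis of `uniformEquilStabilityAt_of_atlas` (ZZZYRCG).  The JS-D K-file's tail obligation per box is therefore: exhibit `np, z` and prove
`SchemeDominatedP` for its tables (enumeration ≤ DFAR plus the remainder lemma of record).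

Theorem file (0 defs, 4 theorems); imports ZZZYRCHA; no instance / notation / option; 0 sorry. [g99]
-/

open scoped BigOperators InnerProductSpace RealInnerProductSpace

namespace Summit.AtomisticToContinuum.Crystallization.Theorems.ChartedZeroExcessLayeredLatticeLiouville

open Summit.AtomisticToContinuum.Crystallization.Theorems.ChartedPlanarOrderRigidityDoor (E3)

/-! ### (FUB): partial sums of the majorants are bounded by the debit form -/

/-- a finite sum of `pairDebit` over in-range pairs is at most the debit form (non-negative tables, finitely supported `φ`). [g99] -/
theorem sum_pairDebit_le_debitForm {ϱ c : ℝ} (hc : 0 < c) {a b : E3} {w : ℤ → E3} (hw : IsLayeredCrystal c a b w)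
    {ΘR ΘN : (Cell 2 × ℤ) × (Cell 2 × ℤ) → ℝ} (hΘR : ∀ y, 0 ≤ ΘR y) (hΘN : ∀ y, 0 ≤ ΘN y) (φ : Cell 2 → ℤ → E3)
    (hφ : HasFiniteSupport φ) (P : Finset ((Cell 2 × ℤ) × (Cell 2 × ℤ)))
    (hPin : ∀ y ∈ P, 0 < ‖bondVec a b w y‖ ∧ ‖bondVec a b w y‖ ≤ ϱ) :
    ∑ y ∈ P, pairDebit ΘR ΘN a b w φ y ≤ debitForm ϱ ΘR ΘN a b w φ := by
  classical
  obtain ⟨S, hS⟩ := hφ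
  set D : (Cell 2 × ℤ) × (Cell 2 × ℤ) → ℝ := fun y =>
    if 0 < ‖bondVec a b w y‖ ∧ ‖bondVec a b w y‖ ≤ ϱ then pairDebit ΘR ΘN a b w φ y else 0 with hD_def
  have hpd0 : ∀ y, 0 ≤ pairDebit ΘR ΘN a b w φ y := fun y =>
    add_nonneg (mul_nonneg (hΘR y) (sqStretch_nonneg a b w φ y)) (mul_nonneg (hΘN y) (sq_nonneg _))
  have hD0 : ∀ y, 0 ≤ D y := fun y => by
    simp only [hD_def]
    split_ifs
    · exact hpd0 y
    · exact le_rfl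
  set N := (finite_nearPairs hc hw S ϱ).toFinset with hN_def
  have hsupp : Function.support D ⊆ ↑(P ∪ N) := by
    intro y hy
    rw [Function.mem_support] at hy
    rw [Finset.coe_union, Set.mem_union, Finset.mem_coe, hN_def, Set.Finite.coe_toFinset]
    right
    by_cases h : 0 < ‖bondVec a b w y‖ ∧ ‖bondVec a b w y‖ ≤ ϱ
    · refine ⟨h.2, ?_⟩
      by_contra hor
      apply hy
      have hΔ := diff_eq_zero_of_notMem hS y (not_or.mp hor).1 (not_or.mp hor).2
      simp only [hD_def, if_pos h, pairDebit, sqStretch, hΔ, inner_zero_right, norm_zero]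
      simp
    · exact absurd (by simp only [hD_def, if_neg h]) hy
  calc ∑ y ∈ P, pairDebit ΘR ΘN a b w φ y = ∑ y ∈ P, D y :=
        Finset.sum_congr rfl fun y hy => by simp only [hD_def, if_pos (hPin y hy)]
    _ ≤ ∑ y ∈ P ∪ N, D y := Finset.sum_le_sum_of_subset_of_nonneg Finset.subset_union_left fun y _ _ => hD0 y
    _ = debitForm ϱ ΘR ΘN a b w φ := by
        unfold debitForm
        rw [finsum_eq_sum_of_support_subset _ hsupp]

/-- ★ **(FUB)**: every finite partial sum of the scheme majorants over far pairs is at most the debit form. [g99] -/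
theorem sum_schemeMajorant_le_debitForm {ϱ α c : ℝ} (hc : 0 < c) {a b : E3} {w : ℤ → E3}
    (hw : IsLayeredCrystal c a b w) {np : (Cell 2 × ℤ) × (Cell 2 × ℤ) → ℕ} {z : (Cell 2 × ℤ) × (Cell 2 × ℤ) → ℕ → Cell 2 × ℤ}
    {ΘR ΘN : (Cell 2 × ℤ) × (Cell 2 × ℤ) → ℝ} (hP : IsPathSystem ϱ a b w np z) (hD : SchemeDominatedP ϱ α a b w np z ΘR ΘN)
    (φ : Cell 2 → ℤ → E3) (hφ : HasFiniteSupport φ) (X : Finset ((Cell 2 × ℤ) × (Cell 2 × ℤ)))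
    (hX : ∀ x ∈ X, ϱ < ‖bondVec a b w x‖) :
    ∑ x ∈ X, schemeMajorant α a b w np z φ x ≤ debitForm ϱ ΘR ΘN a b w φ := by
  classical
  have hΘR : ∀ y, 0 ≤ ΘR y := fun y => by simpa using (hD ∅ (by simp) y).1
  have hΘN : ∀ y, 0 ≤ ΘN y := fun y => by simpa using (hD ∅ (by simp) y).2
  set P : Finset ((Cell 2 × ℤ) × (Cell 2 × ℤ)) :=
    (X.sigma fun x => Finset.range (np x)).image (fun q => piece z q.1 q.2) with hP_def
  have hPmem : ∀ x ∈ X, ∀ i ∈ Finset.range (np x), piece z x i ∈ P := fun x hx i hi =>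
    Finset.mem_image.mpr ⟨⟨x, i⟩, Finset.mem_sigma.mpr ⟨hx, hi⟩, rfl⟩
  have hPin : ∀ y ∈ P, 0 < ‖bondVec a b w y‖ ∧ ‖bondVec a b w y‖ ≤ ϱ := by
    intro y hy
    obtain ⟨q, hq, rfl⟩ := Finset.mem_image.mp hy
    obtain ⟨hx, hi⟩ := Finset.mem_sigma.mp hq
    exact (hP q.1 (hX q.1 hx)).2.2 q.2 (Finset.mem_range.mp hi)
  have hR : ∑ x ∈ X, ∑ i ∈ Finset.range (np x), schemeCoefR α a b w np z x i * sqStretch a b w φ (piece z x i) ≤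
      ∑ y ∈ P, ΘR y * sqStretch a b w φ y :=
    regroup_le X (fun x => Finset.range (np x)) (piece z) P hPmem (schemeCoefR α a b w np z) (sqStretch a b w φ) ΘR
      (sqStretch_nonneg a b w φ) (fun y => (hD X hX y).1)
  have hN : ∑ x ∈ X, ∑ i ∈ Finset.range (np x),
      schemeCoefN α a b w np z x i * ‖φ (z x (i + 1)).1 (z x (i + 1)).2 - φ (z x i).1 (z x i).2‖ ^ 2 ≤
      ∑ y ∈ P, ΘN y * ‖φ y.2.1 y.2.2 - φ y.1.1 y.1.2‖ ^ 2 :=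
    regroup_le X (fun x => Finset.range (np x)) (piece z) P hPmem (schemeCoefN α a b w np z)
      (fun y => ‖φ y.2.1 y.2.2 - φ y.1.1 y.1.2‖ ^ 2) ΘN (fun y => sq_nonneg _) (fun y => (hD X hX y).2)
  calc ∑ x ∈ X, schemeMajorant α a b w np z φ x
        = (∑ x ∈ X, ∑ i ∈ Finset.range (np x), schemeCoefR α a b w np z x i * sqStretch a b w φ (piece z x i)) +
          ∑ x ∈ X, ∑ i ∈ Finset.range (np x),
            schemeCoefN α a b w np z x i * ‖φ (z x (i + 1)).1 (z x (i + 1)).2 - φ (z x i).1 (z x i).2‖ ^ 2 := by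
          rw [← Finset.sum_add_distrib]
          exact Finset.sum_congr rfl fun x _ => Finset.sum_add_distrib
    _ ≤ (∑ y ∈ P, ΘR y * sqStretch a b w φ y) + ∑ y ∈ P, ΘN y * ‖φ y.2.1 y.2.2 - φ y.1.1 y.1.2‖ ^ 2 := add_le_add hR hN
    _ = ∑ y ∈ P, pairDebit ΘR ΘN a b w φ y := by
          rw [← Finset.sum_add_distrib]
          rfl
    _ ≤ debitForm ϱ ΘR ΘN a b w φ := sum_pairDebit_le_debitForm hc hw hΘR hΘN φ hφ P hPin

/-! ### (TL-2) + assembly: the generic tail theorem -/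

/-- ★★ **THE GENERIC TAIL THEOREM of line (D)**: on a `c`-co-Lipschitz layered word with a path system and dominated tables,
`rangeHessSum ϱ − debitForm ϱ ΘR ΘN ≤ E` for every finitely supported `φ` and every value `E` of the ordered-pair harmonic form. [g99] -/
theorem rangeHessSum_sub_debitForm_le {ϱ α c : ℝ} (hϱ : 1 ≤ ϱ) (hα : 0 < α) (hc : 0 < c) {a b : E3} {w : ℤ → E3}
    (hw : IsLayeredCrystal c a b w) {np : (Cell 2 × ℤ) × (Cell 2 × ℤ) → ℕ} {z : (Cell 2 × ℤ) × (Cell 2 × ℤ) → ℕ → Cell 2 × ℤ}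
    {ΘR ΘN : (Cell 2 × ℤ) × (Cell 2 × ℤ) → ℝ} (hP : IsPathSystem ϱ a b w np z) (hD : SchemeDominatedP ϱ α a b w np z ΘR ΘN)
    (φ : Cell 2 → ℤ → E3) (hφ : HasFiniteSupport φ) {E : ℝ} (hE : HasSum (fun x => pairHess a b w φ x) E) :
    rangeHessSum ϱ a b w φ - debitForm ϱ ΘR ΘN a b w φ ≤ E := by
  classical
  obtain ⟨S, hS⟩ := hφ
  -- the summand vanishes off the pairs touching `S`
  have hf0 : ∀ x : (Cell 2 × ℤ) × (Cell 2 × ℤ), x.1 ∉ S → x.2 ∉ S → pairHess a b w φ x = 0 := fun x h1 h2 => by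
    simp only [pairHess, diff_eq_zero_of_notMem hS x h1 h2, inner_zero_left]
  -- near / far split of the summand
  set gn : (Cell 2 × ℤ) × (Cell 2 × ℤ) → ℝ := fun x => if ‖bondVec a b w x‖ ≤ ϱ then pairHess a b w φ x else 0 with hgn_def
  set gf : (Cell 2 × ℤ) × (Cell 2 × ℤ) → ℝ := fun x => if ϱ < ‖bondVec a b w x‖ then pairHess a b w φ x else 0 with hgf_def
  have hfg : ∀ x, pairHess a b w φ x - gn x = gf x := fun x => by
    by_cases h : ‖bondVec a b w x‖ ≤ ϱ
    · simp only [hgn_def, hgf_def, if_pos h, if_neg (not_lt.mpr h), sub_self]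
    · simp only [hgn_def, hgf_def, if_neg h, if_pos (lt_of_not_ge h), sub_zero]
  -- the near part is finitely supported
  set N := (finite_nearPairs hc hw S ϱ).toFinset with hN_def
  have hgnN : ∀ x ∉ N, gn x = 0 := by
    intro x hx
    simp only [hgn_def]
    split_ifs with h
    · by_contra hne
      apply hx
      rw [hN_def, Set.Finite.mem_toFinset]
      refine ⟨h, ?_⟩
      by_contra hor
      exact hne (hf0 x (not_or.mp hor).1 (not_or.mp hor).2)
    · rfl
  have hgn : HasSum gn (∑ x ∈ N, gn x) := hasSum_sum_of_ne_finset_zero hgnN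
  -- and equals `rangeHessSum ϱ` (pairs of length zero are diagonal, by injectivity of the site map)
  have hFg : ∀ x, (if 0 < ‖bondVec a b w x‖ ∧ ‖bondVec a b w x‖ ≤ ϱ then pairHess a b w φ x else 0) = gn x := by
    intro x
    by_cases h0 : 0 < ‖bondVec a b w x‖
    · by_cases h1 : ‖bondVec a b w x‖ ≤ ϱ
      · simp only [hgn_def, h0, h1, and_self, if_true]
      · simp only [hgn_def, h0, h1, and_false, if_false]
    · have he : bondVec a b w x = 0 := norm_le_zero_iff.mp (not_lt.mp h0)
      have hx : x.2 = x.1 := injective_lsite_of_isLayeredCrystal hc hw (sub_eq_zero.mp he)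
      have hfx : pairHess a b w φ x = 0 := by
        simp only [pairHess, hx, sub_self, inner_zero_left]
      simp only [hgn_def, h0, false_and, hfx, ite_self]
  have hnear : ∑ x ∈ N, gn x = rangeHessSum ϱ a b w φ := by
    unfold rangeHessSum
    rw [finsum_eq_sum_of_support_subset _ (s := N) ?_]
    · exact Finset.sum_congr rfl fun x _ => (hFg x).symm
    · intro x hx
      have hx' : gn x ≠ 0 := by rwa [Function.mem_support, hFg] at hx
      by_contra h
      exact hx' (hgnN x (by simpa using h))
  -- the far `HasSum`
  have hgf : HasSum gf (E - rangeHessSum ϱ a b w φ) := by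
    have h := hE.sub hgn
    rw [hnear] at h
    have hfun : (fun x => pairHess a b w φ x - gn x) = gf := funext hfg
    rwa [hfun] at h
  -- the majorant family: non-negative, bounded partial sums ⇒ summable with `tsum ≤ debitForm`
  set G : (Cell 2 × ℤ) × (Cell 2 × ℤ) → ℝ := fun x =>
    if ϱ < ‖bondVec a b w x‖ then schemeMajorant α a b w np z φ x else 0 with hG_def
  have hG0 : 0 ≤ G := fun x => by
    simp only [hG_def, Pi.zero_apply]
    split_ifs
    · exact schemeMajorant_nonneg hα a b w np z φ x
    · exact le_rfl
  have hGle : ∀ X : Finset ((Cell 2 × ℤ) × (Cell 2 × ℤ)), ∑ x ∈ X, G x ≤ debitForm ϱ ΘR ΘN a b w φ := by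
    intro X
    rw [← Finset.sum_filter_add_sum_filter_not X (fun x => ϱ < ‖bondVec a b w x‖)]
    have hz : ∑ x ∈ X.filter (fun x => ¬ϱ < ‖bondVec a b w x‖), G x = 0 :=
      Finset.sum_eq_zero fun x hx => by
        simp only [Finset.mem_filter] at hx
        simp only [hG_def, if_neg hx.2]
    rw [hz, add_zero]
    have hXf : ∀ x ∈ X.filter (fun x => ϱ < ‖bondVec a b w x‖), ϱ < ‖bondVec a b w x‖ := fun x hx =>
      (Finset.mem_filter.mp hx).2
    have hGX : ∑ x ∈ X.filter (fun x => ϱ < ‖bondVec a b w x‖), G x =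
        ∑ x ∈ X.filter (fun x => ϱ < ‖bondVec a b w x‖), schemeMajorant α a b w np z φ x :=
      Finset.sum_congr rfl fun x hx => by simp only [hG_def, if_pos (hXf x hx)]
    rw [hGX]
    exact sum_schemeMajorant_le_debitForm hc hw hP hD φ ⟨S, hS⟩ _ hXf
  have hGsum : Summable G := summable_of_sum_le hG0 hGle
  have hGt : ∑' x, G x ≤ debitForm ϱ ΘR ΘN a b w φ := hGsum.tsum_le_of_sum_le hGle
  -- termwise far bound and `hasSum_le`
  have hterm : ∀ x, -G x ≤ gf x := fun x => by
    simp only [hG_def, hgf_def]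
    split_ifs with h
    · exact far_pair_lower hϱ hα hP φ x h
    · simp
  have hle : -(∑' x, G x) ≤ E - rangeHessSum ϱ a b w φ := by
    have h := hasSum_le hterm hGsum.hasSum.neg hgf
    exact h
  linarith

/-- ★★ **COROLLARY — the per-box tail obligation of the atlas door**: a box whose admissible words carry a path system with dominated tables
satisfies `BoxTailDebitP … 0` (the `htail` hypothesis of `uniformEquilStabilityAt_of_atlas`, ZZZYRCG, with `γT = 0`). [g99] -/
theorem boxTailDebitP_of_scheme {s Λ c₀ ℓ₀ ϱ α : ℝ} (hϱ : 1 ≤ ϱ) (hα : 0 < α) (hc₀ : 0 < c₀)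
    {B : (E3 ≃L[ℝ] E3) → (ℤ → E3) → Prop} {np : (E3 ≃L[ℝ] E3) → (ℤ → E3) → (Cell 2 × ℤ) × (Cell 2 × ℤ) → ℕ}
    {z : (E3 ≃L[ℝ] E3) → (ℤ → E3) → (Cell 2 × ℤ) × (Cell 2 × ℤ) → ℕ → Cell 2 × ℤ}
    {ΘR ΘN : (E3 ≃L[ℝ] E3) → (ℤ → E3) → (Cell 2 × ℤ) × (Cell 2 × ℤ) → ℝ}
    (h : BoxSchemeP s Λ c₀ ℓ₀ ϱ α B np z ΘR ΘN) : BoxTailDebitP s Λ c₀ ℓ₀ ϱ B ΘR ΘN 0 := by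
  intro a ha L w' hA hB φ hφ E hE
  obtain ⟨hP, hD⟩ := h a ha L w' hA hB
  have hw : IsLayeredCrystal c₀ (gen₁ L) (gen₂ L) w' := hA.2.2.2.1
  have hmain := rangeHessSum_sub_debitForm_le hϱ hα hc₀ hw hP hD φ hφ (E := E) hE
  simpa using hmain

end Summit.AtomisticToContinuum.Crystallization.Theorems.ChartedZeroExcessLayeredLatticeLiouville
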